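import Summits.BirchSwinnertonDyer.BirchSwinnertonDyer.Theorems.KolyvaginDepthDoorDepthTableSteinWuthrichRankThree5077a1Exact
import Summits.BirchSwinnertonDyer.BirchSwinnertonDyer.Theorems.KolyvaginDepthDoorDepthTableRowsIntrinsicOdd1
import Summits.BirchSwinnertonDyer.BirchSwinnertonDyer.Theorems.KolyvaginDepthDoorDepthTableRowsIntrinsicOdd2
import Summits.BirchSwinnertonDyer.BirchSwinnertonDyer.Theorems.KolyvaginDepthDoorDepthTableIntrinsicOddRank
import Summits.BirchSwinnertonDyer.BirchSwinnertonDyer.Theorems.KolyvaginDepthDoorDepthTableIntrinsicSemistable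
import HarnessLib

/-!
# Route `KolyvaginDepthDoor`, crux `KolyvaginDepthSupplyKN` (stmt-BirchSwinnertonDyer-22820) —
# DEPTH TABLE v16: rank three, `L`-value currency (part 1) — the SEMISTABLE rows `5077a1`, `11197a1`, `16811a1`, `18097b1`, `22481a1` at EVERY `11 ≤ p < 1000`: the hypotheses on the prime reduced to
# «good reduction» and «ordinary» (tower surjectivity is PRINT: Mazur 1978 Thm. 4 + Serre 1972 Prop. 21, granted Mazur's torsion theorem by name)

Helper file of the lead prover of line `levelone` (kdd-p1 g20; `--supports stmt-BirchSwinnertonDyer-22820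
--as helper`); it closes nothing and BSD is NOT proved by it.

The intrinsic rows (`C<label>.cruxBody_intrinsic_at` / `cruxBody_LValue_intrinsic_at`) keep «`ρ_{E,p^n}` onto» as a hypothesis, certified in the
tree only at the prime of record. For a SEMISTABLE curve it is print at every `p ≥ 11` (`tower_surjective_of_semistable_of_eleven_le`, file
`…DepthTableIntrinsicSemistable`). Per curve below: for EVERY prime `11 ≤ p < 1000` of GOOD ORDINARY reduction (the only `p`-hypotheses; Kodaira–Néron
/ ♠ (1) hold at every `p ≥ 5`, ♠ (2) is semistability), EVERY Heegner field `K` (`d_K ∉ {−3,−4}`, `p ∤ d_K`, any parity) and ANY globally minimal model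
`T` of `E^{(d_K)}`, the rank-one BSD-quotient datum (even rank) / the rank-zero `L`-value datum (odd rank) of `T` at `p` gives the clause of
`KolyvaginDepthSupplyKN` at the curve VERBATIM.

CONDITIONAL on Mazur 1977 Thm. 8 (`mazur_torsion`), Stein–Wuthrich 2013 Thm. 1.1, W. Zhang 2014 L8.4 (1) / 9.1, Burungale–Castella–Skinner 2025
Cor. 1.3.1 / Skinner 2016 Thm. C and GZK, BY NAME; per curve; nothing class-wide (the open stub (S♭) is untouched); BSD is NOT proved by any of this.

References: [Mazur1977] Thm. 8; [Mazur1978] Thm. 4; [Serre1972] §5.4 Prop. 21; [SteinWuthrich2013] Thm. 1.1; [WZhang2014] L8.4 (1), Thm. 9.1;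
[BurungaleCastellaSkinner2025] Cor. 1.3.1; [Skinner2016PacificMC] Thm. C; [CremonaAlgorithms1997] Table 1.
-/

set_option linter.dupNamespace false

noncomputable section

open scoped Classical NumberField

namespace Summit.BirchSwinnertonDyer.BirchSwinnertonDyer.Theorems.KolyvaginDepthDoor

open Literature.NumberTheory.EllipticCurves Literature.NumberTheory.EllipticCurves.ModularForms
  WeierstrassCurve NumberField IsDedekindDomain
open Summit.BirchSwinnertonDyer.BirchSwinnertonDyer.Theorems
open Summit.BirchSwinnertonDyer.BirchSwinnertonDyer.Rank2Observatory
open Summit.BirchSwinnertonDyer.BirchSwinnertonDyer.Rank1Residual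
open Summit.BirchSwinnertonDyer.Rank1Residual.Additive

namespace C5077a1

/-- **`5077a1` (rank three, semistable) — THE INTRINSIC `L`-VALUE ROW AT EVERY `11 ≤ p < 1000`, hypotheses on `p` reduced to GOOD + ORDINARY**
(depth table v16; `ρ_{E,p^n}` onto at every `p ≥ 11` by Mazur 1978 Thm. 4 + Serre Prop. 21, granted `mazur_torsion`). For every prime
`11 ≤ p < 1000` of good ordinary reduction, every imaginary quadratic Heegner field `K` for `N = 5077` (`d_K ∉ {−3,−4}`, `p ∤ d_K`) and ANY globally
minimal model `T` of `E^{(d_K)}`: «`L(E^{(d_K)},1) ≠ 0` ∧ `ord_p(L(T,1)/Ω_T) ≤ 3`» ⟹ the clause of `KolyvaginDepthSupplyKN` at `W = 5077a1` VERBATIM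
(`tower_surjective_of_semistable_of_eleven_le` + `cruxBody_of_twistLValue_intrinsic_spade`). CONDITIONAL on `mazur_torsion`, Stein–Wuthrich Thm. 1.1,
W. Zhang L8.4 (1) / 9.1, Skinner 2016 Thm. C, GZK by name; per curve; nothing class-wide; BSD is not proved by it. [cite: Mazur1978, Thm. 4 (p. 131)]
[cite: SteinWuthrich2013, Thm. 1.1 (p. 1758)] [cite: Skinner2016PacificMC, Thm. C (p. 173)] [cite: CremonaAlgorithms1997, Table 1 (5077a1)] -/
theorem cruxBody_LValue_intrinsic_of_eleven_le
    (hMT : ∀ V : WeierstrassCurve ℚ, mazur_torsion V)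
    (hSW : SteinWuthrich2013_sha_inf_torsionBy_eq_bot_of_two_le_rank)
    (h84 : Literature.NumberTheory.EllipticCurves.WZhang2014_lemma84_exists_minimal_kolyvaginClass_one_selmerCard)
    (hSk : Skinner2016_padicValRat_bsd_rank_zero) (hGZK : rank_eq_analyticRank_of_analyticRank_le_one)
    (p : ℕ) [hp : Fact p.Prime] (h11 : 11 ≤ p) (hp1000 : p < 1000)
    (hgood : haveI := isElliptic_of_mem_atlasR3A00 mem_atlas; haveI := isGloballyMinimal_of_mem_atlasR3A00 mem_atlas; (c5077a1.e.baseChange ℚ).HasGoodReductionAtPrime p)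
    (hord : haveI := isElliptic_of_mem_atlasR3A00 mem_atlas; haveI := isGloballyMinimal_of_mem_atlasR3A00 mem_atlas; ¬ (p : ℤ) ∣ (c5077a1.e.baseChange ℚ).frobeniusTrace p)
    (K : Type) [Field K] [NumberField K] (hK : IsImaginaryQuadratic K)
    (hD3 : NumberField.discr K ≠ -3) (hD4 : NumberField.discr K ≠ -4) (hpD : ¬ ((p : ℤ) ∣ NumberField.discr K))
    (hH : SatisfiesHeegnerHypothesis 5077 K)
    (T : WeierstrassCurve ℚ) [T.IsElliptic] [T.IsGloballyMinimal] (C : WeierstrassCurve.VariableChange ℚ)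
    (hC : C • T = (c5077a1.e.baseChange ℚ).quadraticTwist (NumberField.discr K : ℚ))
    (hL : ((c5077a1.e.baseChange ℚ).quadraticTwist (NumberField.discr K : ℚ)).entireLFunction 1 ≠ 0)
    (hval : ∀ q : ℚ, T.entireLFunction 1 / ((T.realPeriodRat : ℝ) : ℂ) = (q : ℂ) → padicValRat p q ≤ 3) :
    haveI := isElliptic_of_mem_atlasR3A00 mem_atlas; haveI := isGloballyMinimal_of_mem_atlasR3A00 mem_atlas;
    ∃ (p : ℕ) (hp : Fact p.Prime), 5 ≤ p ∧ (c5077a1.e.baseChange ℚ).HasGoodReductionAtPrime p ∧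
      ¬ (p : ℤ) ∣ (c5077a1.e.baseChange ℚ).frobeniusTrace p ∧ (∀ n : ℕ, (c5077a1.e.baseChange ℚ).HasSurjectiveModNGaloisRep (p ^ n : ℕ)) ∧
      (∀ v : HeightOneSpectrum (𝓞 ℚ), (c5077a1.e.baseChange ℚ).HasMultiplicativeReductionAt v →
        ¬ p ∣ (c5077a1.e.baseChange ℚ).ordMinimalDiscriminant v) ∧
      ∃ (K : Type) (_ : Field K) (_ : NumberField K), IsImaginaryQuadratic K ∧
        NumberField.discr K ≠ -3 ∧ NumberField.discr K ≠ -4 ∧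
        ∃ (_ : NeZero ((c5077a1.e.baseChange ℚ).conductorNorm ℤ)), SatisfiesHeegnerHypothesis ((c5077a1.e.baseChange ℚ).conductorNorm ℤ) K ∧
        ∃ (Dt : ModularParametrizationData (c5077a1.e.baseChange ℚ) ((c5077a1.e.baseChange ℚ).conductorNorm ℤ)) (β : ℤ) (ι : K →+* ℂ) (n₁ : ℕ)
          (d : KolyvaginHeegnerData Dt β ι n₁), Squarefree n₁ ∧
          (∀ q ∈ n₁.primeFactors, Zhang2014.IsKolyvaginPrime ((c5077a1.e.baseChange ℚ).conductorNorm ℤ) (c5077a1.e.baseChange ℚ) K p q) ∧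
          d.kolyvaginClass hp.out 1 ≠ 0 ∧
          (n₁.primeFactors.card + 1 ≤ (c5077a1.e.baseChange ℚ).mordellWeilRank ∨
            (n₁.primeFactors.card ≤ (c5077a1.e.baseChange ℚ).mordellWeilRank ∧
              n₁.primeFactors.card + 1 ≤ ((c5077a1.e.baseChange ℚ).quadraticTwist (NumberField.discr K : ℚ)).mordellWeilRank)) := by
  haveI := isElliptic_of_mem_atlasR3A00 mem_atlas; haveI := isGloballyMinimal_of_mem_atlasR3A00 mem_atlas
  haveI iNZ : NeZero ((c5077a1.e.baseChange ℚ).conductorNorm ℤ) := neZero_conductorNorm_of_isElliptic _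
  have hsp := spadeOne_of_prime p
  have hHN : SatisfiesHeegnerHypothesis ((c5077a1.e.baseChange ℚ).conductorNorm ℤ) K := by rw [conductorNorm_eq]; exact hH
  have hS2 : ¬ Squarefree ((c5077a1.e.baseChange ℚ).conductorNorm ℤ) →
      (∃ (ℓ : ℕ) (_ : Fact ℓ.Prime), (c5077a1.e.baseChange ℚ).HasMultiplicativeReductionAtPrime ℓ ∧
          ¬ p ∣ padicValInt ℓ (c5077a1.e.baseChange ℚ).minimalDiscriminantInt) ∧
        ∃ (ℓ₁ ℓ₂ : ℕ) (_ : Fact ℓ₁.Prime) (_ : Fact ℓ₂.Prime), ℓ₁ ≠ ℓ₂ ∧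
          (c5077a1.e.baseChange ℚ).HasMultiplicativeReductionAtPrime ℓ₁ ∧ (c5077a1.e.baseChange ℚ).HasMultiplicativeReductionAtPrime ℓ₂ :=
    fun hns ↦ absurd ((c5077a1.e.baseChange ℚ).isSemistable_iff_squarefree_conductorNorm.mp hsp.2) hns
  have hmult : ∃ ℓ : ℕ, ∃ _ : Fact ℓ.Prime, (c5077a1.e.baseChange ℚ).HasMultiplicativeReductionAtPrime ℓ :=
    ⟨5077, Fact.mk (by norm_num), by
      haveI := Fact.mk (by norm_num : Nat.Prime 5077)
      exact IntModel.hasMultiplicativeReductionAtPrime_of_intModel intModel 5077 (by decide +kernel) (by decide +kernel)⟩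
  have htower := tower_surjective_of_semistable_of_eleven_le hMT _ hsp.2 p h11
  exact cruxBody_of_twistLValue_intrinsic_spade hSW h84 hSk hGZK _ not_hasCM (le_trans (by norm_num) three_le_rank)
    (by rw [conductorNorm_eq]; norm_num) hmult p (by omega) hp1000 hgood hord htower (kodairaNeron_of_five_le p (by omega)) hsp.1 hS2
    K hK hD3 hD4 hpD hHN T C hC hL 3 three_le_rank hval

end C5077a1

namespace C11197a1

/-- **`11197a1` (rank three, semistable) — THE INTRINSIC `L`-VALUE ROW AT EVERY `11 ≤ p < 1000`, hypotheses on `p` reduced to GOOD + ORDINARY**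
(depth table v16; `ρ_{E,p^n}` onto at every `p ≥ 11` by Mazur 1978 Thm. 4 + Serre Prop. 21, granted `mazur_torsion`). For every prime
`11 ≤ p < 1000` of good ordinary reduction, every imaginary quadratic Heegner field `K` for `N = 11197` (`d_K ∉ {−3,−4}`, `p ∤ d_K`) and ANY globally
minimal model `T` of `E^{(d_K)}`: «`L(E^{(d_K)},1) ≠ 0` ∧ `ord_p(L(T,1)/Ω_T) ≤ 3`» ⟹ the clause of `KolyvaginDepthSupplyKN` at `W = 11197a1` VERBATIM
(`tower_surjective_of_semistable_of_eleven_le` + `cruxBody_of_twistLValue_intrinsic_spade`). CONDITIONAL on `mazur_torsion`, Stein–Wuthrich Thm. 1.1,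
W. Zhang L8.4 (1) / 9.1, Skinner 2016 Thm. C, GZK by name; per curve; nothing class-wide; BSD is not proved by it. [cite: Mazur1978, Thm. 4 (p. 131)]
[cite: SteinWuthrich2013, Thm. 1.1 (p. 1758)] [cite: Skinner2016PacificMC, Thm. C (p. 173)] [cite: CremonaAlgorithms1997, Table 1 (11197a1)] -/
theorem cruxBody_LValue_intrinsic_of_eleven_le
    (hMT : ∀ V : WeierstrassCurve ℚ, mazur_torsion V)
    (hSW : SteinWuthrich2013_sha_inf_torsionBy_eq_bot_of_two_le_rank)
    (h84 : Literature.NumberTheory.EllipticCurves.WZhang2014_lemma84_exists_minimal_kolyvaginClass_one_selmerCard)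
    (hSk : Skinner2016_padicValRat_bsd_rank_zero) (hGZK : rank_eq_analyticRank_of_analyticRank_le_one)
    (p : ℕ) [hp : Fact p.Prime] (h11 : 11 ≤ p) (hp1000 : p < 1000)
    (hgood : haveI := isElliptic_of_mem_atlasR3A00 mem_atlas; haveI := isGloballyMinimal_of_mem_atlasR3A00 mem_atlas; (c11197a1.e.baseChange ℚ).HasGoodReductionAtPrime p)
    (hord : haveI := isElliptic_of_mem_atlasR3A00 mem_atlas; haveI := isGloballyMinimal_of_mem_atlasR3A00 mem_atlas; ¬ (p : ℤ) ∣ (c11197a1.e.baseChange ℚ).frobeniusTrace p)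
    (K : Type) [Field K] [NumberField K] (hK : IsImaginaryQuadratic K)
    (hD3 : NumberField.discr K ≠ -3) (hD4 : NumberField.discr K ≠ -4) (hpD : ¬ ((p : ℤ) ∣ NumberField.discr K))
    (hH : SatisfiesHeegnerHypothesis 11197 K)
    (T : WeierstrassCurve ℚ) [T.IsElliptic] [T.IsGloballyMinimal] (C : WeierstrassCurve.VariableChange ℚ)
    (hC : C • T = (c11197a1.e.baseChange ℚ).quadraticTwist (NumberField.discr K : ℚ))
    (hL : ((c11197a1.e.baseChange ℚ).quadraticTwist (NumberField.discr K : ℚ)).entireLFunction 1 ≠ 0)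
    (hval : ∀ q : ℚ, T.entireLFunction 1 / ((T.realPeriodRat : ℝ) : ℂ) = (q : ℂ) → padicValRat p q ≤ 3) :
    haveI := isElliptic_of_mem_atlasR3A00 mem_atlas; haveI := isGloballyMinimal_of_mem_atlasR3A00 mem_atlas;
    ∃ (p : ℕ) (hp : Fact p.Prime), 5 ≤ p ∧ (c11197a1.e.baseChange ℚ).HasGoodReductionAtPrime p ∧
      ¬ (p : ℤ) ∣ (c11197a1.e.baseChange ℚ).frobeniusTrace p ∧ (∀ n : ℕ, (c11197a1.e.baseChange ℚ).HasSurjectiveModNGaloisRep (p ^ n : ℕ)) ∧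
      (∀ v : HeightOneSpectrum (𝓞 ℚ), (c11197a1.e.baseChange ℚ).HasMultiplicativeReductionAt v →
        ¬ p ∣ (c11197a1.e.baseChange ℚ).ordMinimalDiscriminant v) ∧
      ∃ (K : Type) (_ : Field K) (_ : NumberField K), IsImaginaryQuadratic K ∧
        NumberField.discr K ≠ -3 ∧ NumberField.discr K ≠ -4 ∧
        ∃ (_ : NeZero ((c11197a1.e.baseChange ℚ).conductorNorm ℤ)), SatisfiesHeegnerHypothesis ((c11197a1.e.baseChange ℚ).conductorNorm ℤ) K ∧
        ∃ (Dt : ModularParametrizationData (c11197a1.e.baseChange ℚ) ((c11197a1.e.baseChange ℚ).conductorNorm ℤ)) (β : ℤ) (ι : K →+* ℂ) (n₁ : ℕ)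
          (d : KolyvaginHeegnerData Dt β ι n₁), Squarefree n₁ ∧
          (∀ q ∈ n₁.primeFactors, Zhang2014.IsKolyvaginPrime ((c11197a1.e.baseChange ℚ).conductorNorm ℤ) (c11197a1.e.baseChange ℚ) K p q) ∧
          d.kolyvaginClass hp.out 1 ≠ 0 ∧
          (n₁.primeFactors.card + 1 ≤ (c11197a1.e.baseChange ℚ).mordellWeilRank ∨
            (n₁.primeFactors.card ≤ (c11197a1.e.baseChange ℚ).mordellWeilRank ∧
              n₁.primeFactors.card + 1 ≤ ((c11197a1.e.baseChange ℚ).quadraticTwist (NumberField.discr K : ℚ)).mordellWeilRank)) := by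
  haveI := isElliptic_of_mem_atlasR3A00 mem_atlas; haveI := isGloballyMinimal_of_mem_atlasR3A00 mem_atlas
  haveI iNZ : NeZero ((c11197a1.e.baseChange ℚ).conductorNorm ℤ) := neZero_conductorNorm_of_isElliptic _
  have hsp := spadeOne_of_five_le p (by omega)
  have hHN : SatisfiesHeegnerHypothesis ((c11197a1.e.baseChange ℚ).conductorNorm ℤ) K := by rw [conductorNorm_eq]; exact hH
  have hS2 : ¬ Squarefree ((c11197a1.e.baseChange ℚ).conductorNorm ℤ) →
      (∃ (ℓ : ℕ) (_ : Fact ℓ.Prime), (c11197a1.e.baseChange ℚ).HasMultiplicativeReductionAtPrime ℓ ∧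
          ¬ p ∣ padicValInt ℓ (c11197a1.e.baseChange ℚ).minimalDiscriminantInt) ∧
        ∃ (ℓ₁ ℓ₂ : ℕ) (_ : Fact ℓ₁.Prime) (_ : Fact ℓ₂.Prime), ℓ₁ ≠ ℓ₂ ∧
          (c11197a1.e.baseChange ℚ).HasMultiplicativeReductionAtPrime ℓ₁ ∧ (c11197a1.e.baseChange ℚ).HasMultiplicativeReductionAtPrime ℓ₂ :=
    fun hns ↦ absurd ((c11197a1.e.baseChange ℚ).isSemistable_iff_squarefree_conductorNorm.mp hsp.2) hns
  have hmult : ∃ ℓ : ℕ, ∃ _ : Fact ℓ.Prime, (c11197a1.e.baseChange ℚ).HasMultiplicativeReductionAtPrime ℓ :=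
    ⟨11197, Fact.mk (by norm_num), by
      haveI := Fact.mk (by norm_num : Nat.Prime 11197)
      exact IntModel.hasMultiplicativeReductionAtPrime_of_intModel intModel 11197 (by decide +kernel) (by decide +kernel)⟩
  have htower := tower_surjective_of_semistable_of_eleven_le hMT _ hsp.2 p h11
  exact cruxBody_of_twistLValue_intrinsic_spade hSW h84 hSk hGZK _ not_hasCM (le_trans (by norm_num) three_le_rank)
    (by rw [conductorNorm_eq]; norm_num) hmult p (by omega) hp1000 hgood hord htower (kodairaNeron_of_five_le p (by omega)) hsp.1 hS2
    K hK hD3 hD4 hpD hHN T C hC hL 3 three_le_rank hval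

end C11197a1

namespace C16811a1

/-- **`16811a1` (rank three, semistable) — THE INTRINSIC `L`-VALUE ROW AT EVERY `11 ≤ p < 1000`, hypotheses on `p` reduced to GOOD + ORDINARY**
(depth table v16; `ρ_{E,p^n}` onto at every `p ≥ 11` by Mazur 1978 Thm. 4 + Serre Prop. 21, granted `mazur_torsion`). For every prime
`11 ≤ p < 1000` of good ordinary reduction, every imaginary quadratic Heegner field `K` for `N = 16811` (`d_K ∉ {−3,−4}`, `p ∤ d_K`) and ANY globally
minimal model `T` of `E^{(d_K)}`: «`L(E^{(d_K)},1) ≠ 0` ∧ `ord_p(L(T,1)/Ω_T) ≤ 3`» ⟹ the clause of `KolyvaginDepthSupplyKN` at `W = 16811a1` VERBATIM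
(`tower_surjective_of_semistable_of_eleven_le` + `cruxBody_of_twistLValue_intrinsic_spade`). CONDITIONAL on `mazur_torsion`, Stein–Wuthrich Thm. 1.1,
W. Zhang L8.4 (1) / 9.1, Skinner 2016 Thm. C, GZK by name; per curve; nothing class-wide; BSD is not proved by it. [cite: Mazur1978, Thm. 4 (p. 131)]
[cite: SteinWuthrich2013, Thm. 1.1 (p. 1758)] [cite: Skinner2016PacificMC, Thm. C (p. 173)] [cite: CremonaAlgorithms1997, Table 1 (16811a1)] -/
theorem cruxBody_LValue_intrinsic_of_eleven_le
    (hMT : ∀ V : WeierstrassCurve ℚ, mazur_torsion V)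
    (hSW : SteinWuthrich2013_sha_inf_torsionBy_eq_bot_of_two_le_rank)
    (h84 : Literature.NumberTheory.EllipticCurves.WZhang2014_lemma84_exists_minimal_kolyvaginClass_one_selmerCard)
    (hSk : Skinner2016_padicValRat_bsd_rank_zero) (hGZK : rank_eq_analyticRank_of_analyticRank_le_one)
    (p : ℕ) [hp : Fact p.Prime] (h11 : 11 ≤ p) (hp1000 : p < 1000)
    (hgood : haveI := isElliptic_of_mem_atlasR3A00 mem_atlas; haveI := isGloballyMinimal_of_mem_atlasR3A00 mem_atlas; (c16811a1.e.baseChange ℚ).HasGoodReductionAtPrime p)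
    (hord : haveI := isElliptic_of_mem_atlasR3A00 mem_atlas; haveI := isGloballyMinimal_of_mem_atlasR3A00 mem_atlas; ¬ (p : ℤ) ∣ (c16811a1.e.baseChange ℚ).frobeniusTrace p)
    (K : Type) [Field K] [NumberField K] (hK : IsImaginaryQuadratic K)
    (hD3 : NumberField.discr K ≠ -3) (hD4 : NumberField.discr K ≠ -4) (hpD : ¬ ((p : ℤ) ∣ NumberField.discr K))
    (hH : SatisfiesHeegnerHypothesis 16811 K)
    (T : WeierstrassCurve ℚ) [T.IsElliptic] [T.IsGloballyMinimal] (C : WeierstrassCurve.VariableChange ℚ)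
    (hC : C • T = (c16811a1.e.baseChange ℚ).quadraticTwist (NumberField.discr K : ℚ))
    (hL : ((c16811a1.e.baseChange ℚ).quadraticTwist (NumberField.discr K : ℚ)).entireLFunction 1 ≠ 0)
    (hval : ∀ q : ℚ, T.entireLFunction 1 / ((T.realPeriodRat : ℝ) : ℂ) = (q : ℂ) → padicValRat p q ≤ 3) :
    haveI := isElliptic_of_mem_atlasR3A00 mem_atlas; haveI := isGloballyMinimal_of_mem_atlasR3A00 mem_atlas;
    ∃ (p : ℕ) (hp : Fact p.Prime), 5 ≤ p ∧ (c16811a1.e.baseChange ℚ).HasGoodReductionAtPrime p ∧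
      ¬ (p : ℤ) ∣ (c16811a1.e.baseChange ℚ).frobeniusTrace p ∧ (∀ n : ℕ, (c16811a1.e.baseChange ℚ).HasSurjectiveModNGaloisRep (p ^ n : ℕ)) ∧
      (∀ v : HeightOneSpectrum (𝓞 ℚ), (c16811a1.e.baseChange ℚ).HasMultiplicativeReductionAt v →
        ¬ p ∣ (c16811a1.e.baseChange ℚ).ordMinimalDiscriminant v) ∧
      ∃ (K : Type) (_ : Field K) (_ : NumberField K), IsImaginaryQuadratic K ∧
        NumberField.discr K ≠ -3 ∧ NumberField.discr K ≠ -4 ∧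
        ∃ (_ : NeZero ((c16811a1.e.baseChange ℚ).conductorNorm ℤ)), SatisfiesHeegnerHypothesis ((c16811a1.e.baseChange ℚ).conductorNorm ℤ) K ∧
        ∃ (Dt : ModularParametrizationData (c16811a1.e.baseChange ℚ) ((c16811a1.e.baseChange ℚ).conductorNorm ℤ)) (β : ℤ) (ι : K →+* ℂ) (n₁ : ℕ)
          (d : KolyvaginHeegnerData Dt β ι n₁), Squarefree n₁ ∧
          (∀ q ∈ n₁.primeFactors, Zhang2014.IsKolyvaginPrime ((c16811a1.e.baseChange ℚ).conductorNorm ℤ) (c16811a1.e.baseChange ℚ) K p q) ∧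
          d.kolyvaginClass hp.out 1 ≠ 0 ∧
          (n₁.primeFactors.card + 1 ≤ (c16811a1.e.baseChange ℚ).mordellWeilRank ∨
            (n₁.primeFactors.card ≤ (c16811a1.e.baseChange ℚ).mordellWeilRank ∧
              n₁.primeFactors.card + 1 ≤ ((c16811a1.e.baseChange ℚ).quadraticTwist (NumberField.discr K : ℚ)).mordellWeilRank)) := by
  haveI := isElliptic_of_mem_atlasR3A00 mem_atlas; haveI := isGloballyMinimal_of_mem_atlasR3A00 mem_atlas
  haveI iNZ : NeZero ((c16811a1.e.baseChange ℚ).conductorNorm ℤ) := neZero_conductorNorm_of_isElliptic _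
  have hsp := spadeOne_of_five_le p (by omega)
  have hHN : SatisfiesHeegnerHypothesis ((c16811a1.e.baseChange ℚ).conductorNorm ℤ) K := by rw [conductorNorm_eq]; exact hH
  have hS2 : ¬ Squarefree ((c16811a1.e.baseChange ℚ).conductorNorm ℤ) →
      (∃ (ℓ : ℕ) (_ : Fact ℓ.Prime), (c16811a1.e.baseChange ℚ).HasMultiplicativeReductionAtPrime ℓ ∧
          ¬ p ∣ padicValInt ℓ (c16811a1.e.baseChange ℚ).minimalDiscriminantInt) ∧
        ∃ (ℓ₁ ℓ₂ : ℕ) (_ : Fact ℓ₁.Prime) (_ : Fact ℓ₂.Prime), ℓ₁ ≠ ℓ₂ ∧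
          (c16811a1.e.baseChange ℚ).HasMultiplicativeReductionAtPrime ℓ₁ ∧ (c16811a1.e.baseChange ℚ).HasMultiplicativeReductionAtPrime ℓ₂ :=
    fun hns ↦ absurd ((c16811a1.e.baseChange ℚ).isSemistable_iff_squarefree_conductorNorm.mp hsp.2) hns
  have hmult : ∃ ℓ : ℕ, ∃ _ : Fact ℓ.Prime, (c16811a1.e.baseChange ℚ).HasMultiplicativeReductionAtPrime ℓ :=
    ⟨16811, Fact.mk (by norm_num), by
      haveI := Fact.mk (by norm_num : Nat.Prime 16811)
      exact IntModel.hasMultiplicativeReductionAtPrime_of_intModel intModel 16811 (by decide +kernel) (by decide +kernel)⟩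
  have htower := tower_surjective_of_semistable_of_eleven_le hMT _ hsp.2 p h11
  exact cruxBody_of_twistLValue_intrinsic_spade hSW h84 hSk hGZK _ not_hasCM (le_trans (by norm_num) three_le_rank)
    (by rw [conductorNorm_eq]; norm_num) hmult p (by omega) hp1000 hgood hord htower (kodairaNeron_of_five_le p (by omega)) hsp.1 hS2
    K hK hD3 hD4 hpD hHN T C hC hL 3 three_le_rank hval

end C16811a1

namespace C18097b1

/-- **`18097b1` (rank three, semistable) — THE INTRINSIC `L`-VALUE ROW AT EVERY `11 ≤ p < 1000`, hypotheses on `p` reduced to GOOD + ORDINARY**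
(depth table v16; `ρ_{E,p^n}` onto at every `p ≥ 11` by Mazur 1978 Thm. 4 + Serre Prop. 21, granted `mazur_torsion`). For every prime
`11 ≤ p < 1000` of good ordinary reduction, every imaginary quadratic Heegner field `K` for `N = 18097` (`d_K ∉ {−3,−4}`, `p ∤ d_K`) and ANY globally
minimal model `T` of `E^{(d_K)}`: «`L(E^{(d_K)},1) ≠ 0` ∧ `ord_p(L(T,1)/Ω_T) ≤ 3`» ⟹ the clause of `KolyvaginDepthSupplyKN` at `W = 18097b1` VERBATIM
(`tower_surjective_of_semistable_of_eleven_le` + `cruxBody_of_twistLValue_intrinsic_spade`). CONDITIONAL on `mazur_torsion`, Stein–Wuthrich Thm. 1.1,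
W. Zhang L8.4 (1) / 9.1, Skinner 2016 Thm. C, GZK by name; per curve; nothing class-wide; BSD is not proved by it. [cite: Mazur1978, Thm. 4 (p. 131)]
[cite: SteinWuthrich2013, Thm. 1.1 (p. 1758)] [cite: Skinner2016PacificMC, Thm. C (p. 173)] [cite: CremonaAlgorithms1997, Table 1 (18097b1)] -/
theorem cruxBody_LValue_intrinsic_of_eleven_le
    (hMT : ∀ V : WeierstrassCurve ℚ, mazur_torsion V)
    (hSW : SteinWuthrich2013_sha_inf_torsionBy_eq_bot_of_two_le_rank)
    (h84 : Literature.NumberTheory.EllipticCurves.WZhang2014_lemma84_exists_minimal_kolyvaginClass_one_selmerCard)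
    (hSk : Skinner2016_padicValRat_bsd_rank_zero) (hGZK : rank_eq_analyticRank_of_analyticRank_le_one)
    (p : ℕ) [hp : Fact p.Prime] (h11 : 11 ≤ p) (hp1000 : p < 1000)
    (hgood : haveI := isElliptic_of_mem_atlasR3A00 mem_atlas; haveI := isGloballyMinimal_of_mem_atlasR3A00 mem_atlas; (c18097b1.e.baseChange ℚ).HasGoodReductionAtPrime p)
    (hord : haveI := isElliptic_of_mem_atlasR3A00 mem_atlas; haveI := isGloballyMinimal_of_mem_atlasR3A00 mem_atlas; ¬ (p : ℤ) ∣ (c18097b1.e.baseChange ℚ).frobeniusTrace p)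
    (K : Type) [Field K] [NumberField K] (hK : IsImaginaryQuadratic K)
    (hD3 : NumberField.discr K ≠ -3) (hD4 : NumberField.discr K ≠ -4) (hpD : ¬ ((p : ℤ) ∣ NumberField.discr K))
    (hH : SatisfiesHeegnerHypothesis 18097 K)
    (T : WeierstrassCurve ℚ) [T.IsElliptic] [T.IsGloballyMinimal] (C : WeierstrassCurve.VariableChange ℚ)
    (hC : C • T = (c18097b1.e.baseChange ℚ).quadraticTwist (NumberField.discr K : ℚ))
    (hL : ((c18097b1.e.baseChange ℚ).quadraticTwist (NumberField.discr K : ℚ)).entireLFunction 1 ≠ 0)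
    (hval : ∀ q : ℚ, T.entireLFunction 1 / ((T.realPeriodRat : ℝ) : ℂ) = (q : ℂ) → padicValRat p q ≤ 3) :
    haveI := isElliptic_of_mem_atlasR3A00 mem_atlas; haveI := isGloballyMinimal_of_mem_atlasR3A00 mem_atlas;
    ∃ (p : ℕ) (hp : Fact p.Prime), 5 ≤ p ∧ (c18097b1.e.baseChange ℚ).HasGoodReductionAtPrime p ∧
      ¬ (p : ℤ) ∣ (c18097b1.e.baseChange ℚ).frobeniusTrace p ∧ (∀ n : ℕ, (c18097b1.e.baseChange ℚ).HasSurjectiveModNGaloisRep (p ^ n : ℕ)) ∧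
      (∀ v : HeightOneSpectrum (𝓞 ℚ), (c18097b1.e.baseChange ℚ).HasMultiplicativeReductionAt v →
        ¬ p ∣ (c18097b1.e.baseChange ℚ).ordMinimalDiscriminant v) ∧
      ∃ (K : Type) (_ : Field K) (_ : NumberField K), IsImaginaryQuadratic K ∧
        NumberField.discr K ≠ -3 ∧ NumberField.discr K ≠ -4 ∧
        ∃ (_ : NeZero ((c18097b1.e.baseChange ℚ).conductorNorm ℤ)), SatisfiesHeegnerHypothesis ((c18097b1.e.baseChange ℚ).conductorNorm ℤ) K ∧
        ∃ (Dt : ModularParametrizationData (c18097b1.e.baseChange ℚ) ((c18097b1.e.baseChange ℚ).conductorNorm ℤ)) (β : ℤ) (ι : K →+* ℂ) (n₁ : ℕ)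
          (d : KolyvaginHeegnerData Dt β ι n₁), Squarefree n₁ ∧
          (∀ q ∈ n₁.primeFactors, Zhang2014.IsKolyvaginPrime ((c18097b1.e.baseChange ℚ).conductorNorm ℤ) (c18097b1.e.baseChange ℚ) K p q) ∧
          d.kolyvaginClass hp.out 1 ≠ 0 ∧
          (n₁.primeFactors.card + 1 ≤ (c18097b1.e.baseChange ℚ).mordellWeilRank ∨
            (n₁.primeFactors.card ≤ (c18097b1.e.baseChange ℚ).mordellWeilRank ∧
              n₁.primeFactors.card + 1 ≤ ((c18097b1.e.baseChange ℚ).quadraticTwist (NumberField.discr K : ℚ)).mordellWeilRank)) := by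
  haveI := isElliptic_of_mem_atlasR3A00 mem_atlas; haveI := isGloballyMinimal_of_mem_atlasR3A00 mem_atlas
  haveI iNZ : NeZero ((c18097b1.e.baseChange ℚ).conductorNorm ℤ) := neZero_conductorNorm_of_isElliptic _
  have hsp := spadeOne_of_five_le p (by omega)
  have hHN : SatisfiesHeegnerHypothesis ((c18097b1.e.baseChange ℚ).conductorNorm ℤ) K := by rw [conductorNorm_eq]; exact hH
  have hS2 : ¬ Squarefree ((c18097b1.e.baseChange ℚ).conductorNorm ℤ) →
      (∃ (ℓ : ℕ) (_ : Fact ℓ.Prime), (c18097b1.e.baseChange ℚ).HasMultiplicativeReductionAtPrime ℓ ∧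
          ¬ p ∣ padicValInt ℓ (c18097b1.e.baseChange ℚ).minimalDiscriminantInt) ∧
        ∃ (ℓ₁ ℓ₂ : ℕ) (_ : Fact ℓ₁.Prime) (_ : Fact ℓ₂.Prime), ℓ₁ ≠ ℓ₂ ∧
          (c18097b1.e.baseChange ℚ).HasMultiplicativeReductionAtPrime ℓ₁ ∧ (c18097b1.e.baseChange ℚ).HasMultiplicativeReductionAtPrime ℓ₂ :=
    fun hns ↦ absurd ((c18097b1.e.baseChange ℚ).isSemistable_iff_squarefree_conductorNorm.mp hsp.2) hns
  have hmult : ∃ ℓ : ℕ, ∃ _ : Fact ℓ.Prime, (c18097b1.e.baseChange ℚ).HasMultiplicativeReductionAtPrime ℓ :=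
    ⟨18097, Fact.mk (by norm_num), by
      haveI := Fact.mk (by norm_num : Nat.Prime 18097)
      exact IntModel.hasMultiplicativeReductionAtPrime_of_intModel intModel 18097 (by decide +kernel) (by decide +kernel)⟩
  have htower := tower_surjective_of_semistable_of_eleven_le hMT _ hsp.2 p h11
  exact cruxBody_of_twistLValue_intrinsic_spade hSW h84 hSk hGZK _ not_hasCM (le_trans (by norm_num) three_le_rank)
    (by rw [conductorNorm_eq]; norm_num) hmult p (by omega) hp1000 hgood hord htower (kodairaNeron_of_five_le p (by omega)) hsp.1 hS2
    K hK hD3 hD4 hpD hHN T C hC hL 3 three_le_rank hval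

end C18097b1

namespace C22481a1

/-- **`22481a1` (rank three, semistable) — THE INTRINSIC `L`-VALUE ROW AT EVERY `11 ≤ p < 1000`, hypotheses on `p` reduced to GOOD + ORDINARY**
(depth table v16; `ρ_{E,p^n}` onto at every `p ≥ 11` by Mazur 1978 Thm. 4 + Serre Prop. 21, granted `mazur_torsion`). For every prime
`11 ≤ p < 1000` of good ordinary reduction, every imaginary quadratic Heegner field `K` for `N = 22481` (`d_K ∉ {−3,−4}`, `p ∤ d_K`) and ANY globally
minimal model `T` of `E^{(d_K)}`: «`L(E^{(d_K)},1) ≠ 0` ∧ `ord_p(L(T,1)/Ω_T) ≤ 3`» ⟹ the clause of `KolyvaginDepthSupplyKN` at `W = 22481a1` VERBATIM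
(`tower_surjective_of_semistable_of_eleven_le` + `cruxBody_of_twistLValue_intrinsic_spade`). CONDITIONAL on `mazur_torsion`, Stein–Wuthrich Thm. 1.1,
W. Zhang L8.4 (1) / 9.1, Skinner 2016 Thm. C, GZK by name; per curve; nothing class-wide; BSD is not proved by it. [cite: Mazur1978, Thm. 4 (p. 131)]
[cite: SteinWuthrich2013, Thm. 1.1 (p. 1758)] [cite: Skinner2016PacificMC, Thm. C (p. 173)] [cite: CremonaAlgorithms1997, Table 1 (22481a1)] -/
theorem cruxBody_LValue_intrinsic_of_eleven_le
    (hMT : ∀ V : WeierstrassCurve ℚ, mazur_torsion V)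
    (hSW : SteinWuthrich2013_sha_inf_torsionBy_eq_bot_of_two_le_rank)
    (h84 : Literature.NumberTheory.EllipticCurves.WZhang2014_lemma84_exists_minimal_kolyvaginClass_one_selmerCard)
    (hSk : Skinner2016_padicValRat_bsd_rank_zero) (hGZK : rank_eq_analyticRank_of_analyticRank_le_one)
    (p : ℕ) [hp : Fact p.Prime] (h11 : 11 ≤ p) (hp1000 : p < 1000)
    (hgood : haveI := isElliptic_of_mem_atlasR3A00 mem_atlas; haveI := isGloballyMinimal_of_mem_atlasR3A00 mem_atlas; (c22481a1.e.baseChange ℚ).HasGoodReductionAtPrime p)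
    (hord : haveI := isElliptic_of_mem_atlasR3A00 mem_atlas; haveI := isGloballyMinimal_of_mem_atlasR3A00 mem_atlas; ¬ (p : ℤ) ∣ (c22481a1.e.baseChange ℚ).frobeniusTrace p)
    (K : Type) [Field K] [NumberField K] (hK : IsImaginaryQuadratic K)
    (hD3 : NumberField.discr K ≠ -3) (hD4 : NumberField.discr K ≠ -4) (hpD : ¬ ((p : ℤ) ∣ NumberField.discr K))
    (hH : SatisfiesHeegnerHypothesis 22481 K)
    (T : WeierstrassCurve ℚ) [T.IsElliptic] [T.IsGloballyMinimal] (C : WeierstrassCurve.VariableChange ℚ)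
    (hC : C • T = (c22481a1.e.baseChange ℚ).quadraticTwist (NumberField.discr K : ℚ))
    (hL : ((c22481a1.e.baseChange ℚ).quadraticTwist (NumberField.discr K : ℚ)).entireLFunction 1 ≠ 0)
    (hval : ∀ q : ℚ, T.entireLFunction 1 / ((T.realPeriodRat : ℝ) : ℂ) = (q : ℂ) → padicValRat p q ≤ 3) :
    haveI := isElliptic_of_mem_atlasR3A00 mem_atlas; haveI := isGloballyMinimal_of_mem_atlasR3A00 mem_atlas;
    ∃ (p : ℕ) (hp : Fact p.Prime), 5 ≤ p ∧ (c22481a1.e.baseChange ℚ).HasGoodReductionAtPrime p ∧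
      ¬ (p : ℤ) ∣ (c22481a1.e.baseChange ℚ).frobeniusTrace p ∧ (∀ n : ℕ, (c22481a1.e.baseChange ℚ).HasSurjectiveModNGaloisRep (p ^ n : ℕ)) ∧
      (∀ v : HeightOneSpectrum (𝓞 ℚ), (c22481a1.e.baseChange ℚ).HasMultiplicativeReductionAt v →
        ¬ p ∣ (c22481a1.e.baseChange ℚ).ordMinimalDiscriminant v) ∧
      ∃ (K : Type) (_ : Field K) (_ : NumberField K), IsImaginaryQuadratic K ∧
        NumberField.discr K ≠ -3 ∧ NumberField.discr K ≠ -4 ∧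
        ∃ (_ : NeZero ((c22481a1.e.baseChange ℚ).conductorNorm ℤ)), SatisfiesHeegnerHypothesis ((c22481a1.e.baseChange ℚ).conductorNorm ℤ) K ∧
        ∃ (Dt : ModularParametrizationData (c22481a1.e.baseChange ℚ) ((c22481a1.e.baseChange ℚ).conductorNorm ℤ)) (β : ℤ) (ι : K →+* ℂ) (n₁ : ℕ)
          (d : KolyvaginHeegnerData Dt β ι n₁), Squarefree n₁ ∧
          (∀ q ∈ n₁.primeFactors, Zhang2014.IsKolyvaginPrime ((c22481a1.e.baseChange ℚ).conductorNorm ℤ) (c22481a1.e.baseChange ℚ) K p q) ∧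
          d.kolyvaginClass hp.out 1 ≠ 0 ∧
          (n₁.primeFactors.card + 1 ≤ (c22481a1.e.baseChange ℚ).mordellWeilRank ∨
            (n₁.primeFactors.card ≤ (c22481a1.e.baseChange ℚ).mordellWeilRank ∧
              n₁.primeFactors.card + 1 ≤ ((c22481a1.e.baseChange ℚ).quadraticTwist (NumberField.discr K : ℚ)).mordellWeilRank)) := by
  haveI := isElliptic_of_mem_atlasR3A00 mem_atlas; haveI := isGloballyMinimal_of_mem_atlasR3A00 mem_atlas
  haveI iNZ : NeZero ((c22481a1.e.baseChange ℚ).conductorNorm ℤ) := neZero_conductorNorm_of_isElliptic _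
  have hsp := spadeOne_of_five_le p (by omega)
  have hHN : SatisfiesHeegnerHypothesis ((c22481a1.e.baseChange ℚ).conductorNorm ℤ) K := by rw [conductorNorm_eq]; exact hH
  have hS2 : ¬ Squarefree ((c22481a1.e.baseChange ℚ).conductorNorm ℤ) →
      (∃ (ℓ : ℕ) (_ : Fact ℓ.Prime), (c22481a1.e.baseChange ℚ).HasMultiplicativeReductionAtPrime ℓ ∧
          ¬ p ∣ padicValInt ℓ (c22481a1.e.baseChange ℚ).minimalDiscriminantInt) ∧
        ∃ (ℓ₁ ℓ₂ : ℕ) (_ : Fact ℓ₁.Prime) (_ : Fact ℓ₂.Prime), ℓ₁ ≠ ℓ₂ ∧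
          (c22481a1.e.baseChange ℚ).HasMultiplicativeReductionAtPrime ℓ₁ ∧ (c22481a1.e.baseChange ℚ).HasMultiplicativeReductionAtPrime ℓ₂ :=
    fun hns ↦ absurd ((c22481a1.e.baseChange ℚ).isSemistable_iff_squarefree_conductorNorm.mp hsp.2) hns
  have hmult : ∃ ℓ : ℕ, ∃ _ : Fact ℓ.Prime, (c22481a1.e.baseChange ℚ).HasMultiplicativeReductionAtPrime ℓ :=
    ⟨22481, Fact.mk (by norm_num), by
      haveI := Fact.mk (by norm_num : Nat.Prime 22481)
      exact IntModel.hasMultiplicativeReductionAtPrime_of_intModel intModel 22481 (by decide +kernel) (by decide +kernel)⟩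
  have htower := tower_surjective_of_semistable_of_eleven_le hMT _ hsp.2 p h11
  exact cruxBody_of_twistLValue_intrinsic_spade hSW h84 hSk hGZK _ not_hasCM (le_trans (by norm_num) three_le_rank)
    (by rw [conductorNorm_eq]; norm_num) hmult p (by omega) hp1000 hgood hord htower (kodairaNeron_of_five_le p (by omega)) hsp.1 hS2
    K hK hD3 hD4 hpD hHN T C hC hL 3 three_le_rank hval

end C22481a1

end Summit.BirchSwinnertonDyer.BirchSwinnertonDyer.Theorems.KolyvaginDepthDoor

end
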